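import Summits.BirchSwinnertonDyer.BirchSwinnertonDyer.Theorems.PrintCFramBottomClassIndexLawFiveLeEisensteinEndStateV19ShaPrimitivity
import Summits.BirchSwinnertonDyer.BirchSwinnertonDyer.Theorems.PrintCFramBottomClassIndexLawFiveLeEisensteinEndStateV19Binders
import Summits.BirchSwinnertonDyer.BirchSwinnertonDyer.Theorems.PrintCFramBottomClassIndexLawFiveLeHeegnerTwistShaPartner
import HarnessLib

/-!
# Route `PrintCFram`, crux C2 `BottomClassIndexLawFiveLe` (stmt-BirchSwinnertonDyer-20372), line `eisenstein-resource-bdp-line`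
# (registry v19/v20): **ONE TWIST SUPPLY FOR BOTH SLOTS** — Stub C ⟸ w3 g10's C♭_Ш, so the Kolyvagin-reading END STATE reads
# crux ⟸ prints4 ∧ Mazur–Wiles Thm 2 ∧ Cassels–Tate ∧ Kriz–Li Thm 1.20 ∧ **C♭_Ш** ∧ **B1-sha** ∧ **B1-prim**, and the binders END STATE
# crux ⟸ prints4 ∧ MW ∧ CT ∧ KL ∧ **C♭_Ш** ∧ **B1-level** ∧ **B1-sha**
# (cell `bsd-print-cfram`, width seat `bsd-line-cfram-p1-w5` g4; THEOREMS ONLY, `--supports` 20372; BSD is not proved by any of this)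

HONEST FRAMING. Nothing about BSD is proved here and no stub is closed. w3 g10's `…EisensteinEndStateV19Primitivity` /
`…ShaPrimitivity` carry TWO supply hypotheses of the same analytic kind: registry v19's Stub C (or this seat's C_Ш feeding it) and
**C♭_Ш** := «every rank-one class member `W` with `Ш(W/ℚ)[p] = 0` has an imaginary quadratic `K` Heegner for `N_W`, `d_K` odd `< −4`,
`L(W^{(d_K)},1) ≠ 0`, and a globally minimal model `Wd` of the twist with `Ш(Wd/ℚ)[p] = 0`». This file shows the second ALONE suffices:
Stub C's binders make `W` Eisenstein-REGULAR, and a regular rank-one member has `Ш(W)[p] = 0` ((α′), w6 g3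
`LevelDictionaryAlpha.sha_torsion_eq_zero_of_unit_classFactor`, the generator from GZK via `RamifiedSevenEllipticUnits.exists_generator_with_level`),
so C♭_Ш applies to it; its single `Ш(Wd)[p] = 0` is enough by this seat's `HeegnerTwistSha.not_fieldFactor_le_of_twist_noPTorsion`
(p682546: `#Ш[p^∞]` is constant on the rational `p`-isogeny class of the rank-zero twist — Cassels + Cassels–Tate + the Néron period
relation — so the partner clause of the (β) dictionary is automatic).

* §1 **`stubC_of_twistSupplyFlat`** — Stub C VERBATIM ⟸ C♭_Ш (mod Mazur–Wiles Thm. 2, `ToricPublishedInputs`, Cassels–Tate).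
* §2 **`bottomClassIndexLawFiveLe_of_prints4_of_mazurWiles_of_casselsTate_of_krizLi_of_twistSupply_of_sha_of_heegnerIndex`** —
  crux ⟸ prints4 ∧ MW ∧ CT ∧ KL ∧ C♭_Ш ∧ B1-sha ∧ B1-prim (w3 g10's p680703 with its C slot fed by §1);
  **`bottomClassIndexLawFiveLe_of_prints4_of_mazurWiles_of_casselsTate_of_krizLi_of_twistSupply_of_level_of_sha`** —
  crux ⟸ prints4 ∧ MW ∧ CT ∧ KL ∧ C♭_Ш ∧ B1-level ∧ B1-sha (LEAD g11's p677037 with its C slot fed by §1).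

READING: on this line the whole research residue of C2 is «(C♭_Ш) every regular-or-`Ш[p]`-trivial rank-one class member has ONE admissible
Heegner twist with `L ≠ 0` and `Ш[p] = 0`» + «`BSD_p` on the `Ш(W)[p] ≠ 0` members» + «`BSD_p` on the invisible-generator members |
Kolyvagin `p`-primitivity on the `Ш(W)[p] = 0` members». CONDITIONAL by construction; credits nothing; beyond-print theorem: NO. BSD is not
proved by any of this; no summit statement is proved by this seat. References: [MazurWiles1984] Thm. 2; [KrizLi2019] Thm. 1.20, §8;
[MilneADT2006] Thm. I.7.3; [SilvermanAEC2009] Thm. X.4.14; crux workfiles `…-lead-g11.md`, `…-w3g9-notes.md`, `…-w5g4-notes.md`.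
-/

set_option autoImplicit false
-- `…BirchSwinnertonDyer.BirchSwinnertonDyer.Theorems…` is the problem's mandated namespace (D-0017).
set_option linter.dupNamespace false

noncomputable section

open scoped Classical

namespace Summit.BirchSwinnertonDyer.BirchSwinnertonDyer.Theorems.PrintCFram.EisensteinEndStateV19TwistSupply

open WeierstrassCurve NumberField IsDedekindDomain DirichletCharacter
  Literature.NumberTheory.EllipticCurves
  Literature.NumberTheory.EllipticCurves.ModularForms
  Literature.NumberTheory.EllipticCurves.Rank1Residual
  Literature.NumberTheory.EllipticCurves.KrizLi2019
  Literature.NumberTheory.NumberFields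
  Summit.BirchSwinnertonDyer.Rank1Residual
  Summit.BirchSwinnertonDyer.BirchSwinnertonDyer.Theorems
  Summit.BirchSwinnertonDyer.BirchSwinnertonDyer.Theorems.PrintCFram
  Summit.BirchSwinnertonDyer.BirchSwinnertonDyer.Theorems.PrintCFram.HeegnerTwistSha

/-! ## §1 Stub C from w3 g10's twist supply C♭_Ш alone -/

/-- **STUB C ⟸ C♭_Ш.** Registry v19's Stub C `stub_heegnerField_of_unitClassFactor` — VERBATIM — follows from w3 g10's twist supply
C♭_Ш (the hypothesis `hSup` of `ParitySplit.bsdp_of_noPTorsion_of_heegnerIndex_of_twistSupply`, p680362): a member in Stub C's binders is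
Eisenstein-regular and of rank one, so `Ш(W/ℚ)[p] = 0` ((α′) `LevelDictionaryAlpha.sha_torsion_eq_zero_of_unit_classFactor` at the GZK
generator `RamifiedSevenEllipticUnits.exists_generator_with_level`); C♭_Ш then hands an admissible `K` with `L(W^{(d_K)},1) ≠ 0` and a minimal
twist model with `Ш[p] = 0`, and `HeegnerTwistSha.not_fieldFactor_le_of_twist_noPTorsion` (partner clause automatic) makes the field factor a
unit; the Kronecker character is `OffLocusDictionary.exists_isKroneckerCharacterOf`. CONDITIONAL on `hMW`, `hF` (`ToricPublishedInputs`),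
`hCT`; closes no stub; BSD is not proved by any of this. [cite: MazurWiles1984, Thm. 2 (p. 216)] [cite: KrizLi2019, Thm. 1.20 (p. 8) and §8]
[cite: MilneADT2006, Ch. I, Thm. 7.3] [cite: SilvermanAEC2009, Thm. X.4.14] -/
theorem stubC_of_twistSupplyFlat
    (hMW : MazurWiles1984.thm2_card_oddChiClassGroup_eq_bernoulli)
    (hF : Summit.BirchSwinnertonDyer.BirchSwinnertonDyer.Theses.UniversalToricDescent.ToricPublishedInputs)
    (hCT : exists_casselsTate_pairing (K := ℚ))
    (hSup :
    ∀ (W : WeierstrassCurve ℚ) [W.IsElliptic] [W.IsGloballyMinimal] (p : ℕ) [Fact p.Prime],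
      W.HasCM → CMRamified W p → 5 ≤ p → W.analyticRank = 1 →
      (∀ s ∈ W.sha, p • s = 0 → s = 0) →
      ∃ (K : Type) (_ : Field K) (_ : NumberField K),
        IsImaginaryQuadratic K ∧ SatisfiesHeegnerHypothesis (W.conductorNorm ℤ) K ∧ Odd (NumberField.discr K) ∧
        NumberField.discr K < -4 ∧ (W.quadraticTwist (NumberField.discr K : ℚ)).entireLFunction 1 ≠ 0 ∧
        ∃ (Wd : WeierstrassCurve ℚ) (_ : Wd.IsElliptic) (_ : Wd.IsGloballyMinimal),
          (∃ C : VariableChange ℚ, C • W.quadraticTwist (NumberField.discr K : ℚ) = Wd) ∧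
          ∀ s ∈ Wd.sha, p • s = 0 → s = 0) :
    ∀ (W : WeierstrassCurve ℚ) [W.IsElliptic] [W.IsGloballyMinimal] (p : ℕ) [Fact p.Prime], W.HasCM → CMRamified W p → 5 ≤ p →
      W.analyticRank = 1 → ∀ (f : ℕ) [NeZero f] (ψ : DirichletCharacter ℚ_[p] f) (ω : DirichletCharacter ℚ_[p] p), ψ.Odd →
      IsTeichmullerCharacter ω →
      (∀ ℓ : ℕ, ℓ.Prime → ¬ (ℓ ∣ p * W.conductorNorm ℤ) →
        ‖((W.LFunction ℓ : ℤ) : ℚ_[p]) - (ψ (ℓ : ZMod f) + ψ⁻¹ (ℓ : ZMod f) * ω (ℓ : ZMod p))‖ < 1) →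
      ¬ ‖bernoulliOnePrim ψ⁻¹‖ ≤ (p : ℝ)⁻¹ →
      ∃ (K : Type) (_ : Field K) (_ : NumberField K) (εK : DirichletCharacter ℚ_[p] (NumberField.discr K).natAbs),
        IsImaginaryQuadratic K ∧ SatisfiesHeegnerHypothesis (W.conductorNorm ℤ) K ∧ Odd (NumberField.discr K) ∧
        NumberField.discr K < -4 ∧ IsKroneckerCharacterOf K εK ∧
        ¬ ‖bernoulliOnePrim (bernoulliCharTwo ψ εK ω)‖ ≤ (p : ℝ)⁻¹ := by
  intro W _ _ p _ hCM hram h5 hr f _ ψ ω hψ hω hss hcls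
  obtain ⟨-, -, hGZK, -⟩ := id hF
  -- a regular rank-one member has `Ш(W)[p] = 0` ((α′) at the GZK generator)
  have hrank : W.mordellWeilRank = 1 := by rw [(hGZK W hr.le).1, hr]
  obtain ⟨P, -, hPtor, hgen, -, -⟩ := RamifiedSevenEllipticUnits.exists_generator_with_level W p hrank
  have h0 : ∀ s ∈ W.sha, p • s = 0 → s = 0 := fun s hs hps ↦
    LevelDictionaryAlpha.sha_torsion_eq_zero_of_unit_classFactor W p hCM hram h5 ψ ω hψ hω hss hcls P
      (LevelDictionaryAlpha.forall_zsmul_ne_of_generator p W P hPtor hgen) hs hps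
  obtain ⟨K, iK, iK', hK, hH, hodd, hd4, hLt, Wd, iWd, iWd', hC, hsha⟩ := hSup W p hCM hram h5 hr h0
  obtain ⟨εK, hεK⟩ := OffLocusDictionary.exists_isKroneckerCharacterOf (p := p) hK.1
  exact ⟨K, iK, iK', εK, hK, hH, hodd, hd4, hεK,
    not_fieldFactor_le_of_twist_noPTorsion hMW hF hCT W hCM hram h5 ψ ω hψ hω hss K hK εK hεK Wd hC hLt hsha⟩

/-! ## §2 The END STATEs with the one twist supply -/

/-- **END STATE (Kolyvagin reading): crux ⟸ prints4 ∧ Mazur–Wiles Thm 2 ∧ Cassels–Tate ∧ Kriz–Li Thm 1.20 ∧ C♭_Ш ∧ B1-sha ∧ B1-prim.**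
w3 g10's `EisensteinEndStateV19Primitivity.bottomClassIndexLawFiveLe_of_prints4_of_krizLi_of_cover_of_twistSupply_of_sha_of_heegnerIndex`
with its C slot fed by §1 from the SAME `hSup`. CONDITIONAL by construction; credits nothing; closes no stub; BSD is not proved by any of this.
[cite: MazurWiles1984, Thm. 2 (p. 216)] [cite: KrizLi2019, Thm. 1.20 (p. 8) and §8] [cite: GrossZagier1986, Thm. I.(6.3) and V.§2]
[cite: SilvermanAEC2009, Thm. X.4.14] -/
theorem bottomClassIndexLawFiveLe_of_prints4_of_mazurWiles_of_casselsTate_of_krizLi_of_twistSupply_of_sha_of_heegnerIndex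
    (hprints4 :
    Hsieh2014.thmA_exists_isHsiehLFunction_unrPeriod_anyLevel ∧
    LiuZhangZhang2018.thm151_thm153_modularCurve_heegnerVector_additive ∧
    Summit.BirchSwinnertonDyer.BirchSwinnertonDyer.Theses.UniversalToricDescent.ToricPublishedInputs ∧
    bsdTriple_of_hasCM_of_L_one_ne_zero)
    (hMW : MazurWiles1984.thm2_card_oddChiClassGroup_eq_bernoulli) (hCT : exists_casselsTate_pairing (K := ℚ))
    (hKL : thm120_padicLogHeegner_unit_of_bernoulli)
    (hSup :
    ∀ (W : WeierstrassCurve ℚ) [W.IsElliptic] [W.IsGloballyMinimal] (p : ℕ) [Fact p.Prime],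
      W.HasCM → CMRamified W p → 5 ≤ p → W.analyticRank = 1 →
      (∀ s ∈ W.sha, p • s = 0 → s = 0) →
      ∃ (K : Type) (_ : Field K) (_ : NumberField K),
        IsImaginaryQuadratic K ∧ SatisfiesHeegnerHypothesis (W.conductorNorm ℤ) K ∧ Odd (NumberField.discr K) ∧
        NumberField.discr K < -4 ∧ (W.quadraticTwist (NumberField.discr K : ℚ)).entireLFunction 1 ≠ 0 ∧
        ∃ (Wd : WeierstrassCurve ℚ) (_ : Wd.IsElliptic) (_ : Wd.IsGloballyMinimal),
          (∃ C : VariableChange ℚ, C • W.quadraticTwist (NumberField.discr K : ℚ) = Wd) ∧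
          ∀ s ∈ Wd.sha, p • s = 0 → s = 0)
    (hSha :
    ∀ (W : WeierstrassCurve ℚ) [W.IsElliptic] [W.IsGloballyMinimal] (p : ℕ) [Fact p.Prime],
      W.HasCM → CMRamified W p → 5 ≤ p → W.analyticRank = 1 →
      (∃ s ∈ W.sha, s ≠ 0 ∧ p • s = 0) → BSDp W p)
    (hPrim :
    ∀ (W : WeierstrassCurve ℚ) [W.IsElliptic] [W.IsGloballyMinimal] (p : ℕ) [Fact p.Prime],
      W.HasCM → CMRamified W p → 5 ≤ p → W.analyticRank = 1 →
      (∀ s ∈ W.sha, p • s = 0 → s = 0) →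
      ∀ (N : ℕ) [NeZero N] (K : Type) [Field K] [NumberField K]
        (Dt : ModularParametrizationData W N) (H : HeegnerDatum N (NumberField.discr K)) (ι : K →+* ℂ)
        (P : (W.baseChange K).toAffine.Point) (Wd : WeierstrassCurve ℚ) [Wd.IsElliptic] [Wd.IsGloballyMinimal],
        W.conductorNorm ℤ = N → IsImaginaryQuadratic K → SatisfiesHeegnerHypothesis N K →
        Odd (NumberField.discr K) → NumberField.discr K < -4 →
        (W.quadraticTwist (NumberField.discr K : ℚ)).entireLFunction 1 ≠ 0 →
        WeierstrassCurve.Affine.Point.map ι.toRatAlgHom P = heegnerPointComplex Dt H →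
        (∃ C : VariableChange ℚ, C • W.quadraticTwist (NumberField.discr K : ℚ) = Wd) →
        (∀ s ∈ Wd.sha, p • s = 0 → s = 0) →
        padicValNat p (AddSubgroup.zmultiples P).index = padicValNat p Dt.c.natAbs) :
    Summit.BirchSwinnertonDyer.BirchSwinnertonDyer.Theses.PrintCFram.BottomClassIndexLawFiveLe :=
  EisensteinEndStateV19Primitivity.bottomClassIndexLawFiveLe_of_prints4_of_krizLi_of_cover_of_twistSupply_of_sha_of_heegnerIndex
    hprints4 hKL (stubC_of_twistSupplyFlat hMW hprints4.2.2.1 hCT hSup) hSup hSha hPrim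

/-- **END STATE (binders reading): crux ⟸ prints4 ∧ Mazur–Wiles Thm 2 ∧ Cassels–Tate ∧ Kriz–Li Thm 1.20 ∧ C♭_Ш ∧ B1-level ∧ B1-sha.**
LEAD g11's `EisensteinEndStateV19Binders.bottomClassIndexLawFiveLe_of_prints4_of_mazurWiles_of_krizLi_of_cover_of_level_of_sha` with its C slot
fed by §1. CONDITIONAL by construction; credits nothing; closes no stub; BSD is not proved by any of this. [cite: MazurWiles1984, Thm. 2 (p. 216)]
[cite: KrizLi2019, Thm. 1.20 (p. 8) and §8] [cite: SilvermanAEC2009, Thm. X.4.14] [cite: BurungaleKobayashiNakamuraOta2026, §1.4] -/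
theorem bottomClassIndexLawFiveLe_of_prints4_of_mazurWiles_of_casselsTate_of_krizLi_of_twistSupply_of_level_of_sha
    (hprints4 :
    Hsieh2014.thmA_exists_isHsiehLFunction_unrPeriod_anyLevel ∧
    LiuZhangZhang2018.thm151_thm153_modularCurve_heegnerVector_additive ∧
    Summit.BirchSwinnertonDyer.BirchSwinnertonDyer.Theses.UniversalToricDescent.ToricPublishedInputs ∧
    bsdTriple_of_hasCM_of_L_one_ne_zero)
    (hMW : MazurWiles1984.thm2_card_oddChiClassGroup_eq_bernoulli) (hCT : exists_casselsTate_pairing (K := ℚ))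
    (hKL : thm120_padicLogHeegner_unit_of_bernoulli)
    (hSup :
    ∀ (W : WeierstrassCurve ℚ) [W.IsElliptic] [W.IsGloballyMinimal] (p : ℕ) [Fact p.Prime],
      W.HasCM → CMRamified W p → 5 ≤ p → W.analyticRank = 1 →
      (∀ s ∈ W.sha, p • s = 0 → s = 0) →
      ∃ (K : Type) (_ : Field K) (_ : NumberField K),
        IsImaginaryQuadratic K ∧ SatisfiesHeegnerHypothesis (W.conductorNorm ℤ) K ∧ Odd (NumberField.discr K) ∧
        NumberField.discr K < -4 ∧ (W.quadraticTwist (NumberField.discr K : ℚ)).entireLFunction 1 ≠ 0 ∧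
        ∃ (Wd : WeierstrassCurve ℚ) (_ : Wd.IsElliptic) (_ : Wd.IsGloballyMinimal),
          (∃ C : VariableChange ℚ, C • W.quadraticTwist (NumberField.discr K : ℚ) = Wd) ∧
          ∀ s ∈ Wd.sha, p • s = 0 → s = 0)
    (hLevel :
    ∀ (W : WeierstrassCurve ℚ) [W.IsElliptic] [W.IsGloballyMinimal] (p : ℕ) [Fact p.Prime],
      W.HasCM → CMRamified W p → 5 ≤ p → W.analyticRank = 1 →
      ∀ P : W.toAffine.Point, ¬ IsOfFinAddOrder P →
        (∀ R : W.toAffine.Point, ∃ (k : ℤ) (T : W.toAffine.Point), IsOfFinAddOrder T ∧ R = k • P + T) →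
        (∃ Q : (W.baseChange ℚ_[p]).toAffine.Point, p • Q = W.toPadicPoint p P) →
        BSDp W p)
    (hSha :
    ∀ (W : WeierstrassCurve ℚ) [W.IsElliptic] [W.IsGloballyMinimal] (p : ℕ) [Fact p.Prime],
      W.HasCM → CMRamified W p → 5 ≤ p → W.analyticRank = 1 →
      (∃ s ∈ W.sha, s ≠ 0 ∧ p • s = 0) → BSDp W p) :
    Summit.BirchSwinnertonDyer.BirchSwinnertonDyer.Theses.PrintCFram.BottomClassIndexLawFiveLe :=
  EisensteinEndStateV19Binders.bottomClassIndexLawFiveLe_of_prints4_of_mazurWiles_of_krizLi_of_cover_of_level_of_sha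
    hprints4 hMW hKL (stubC_of_twistSupplyFlat hMW hprints4.2.2.1 hCT hSup) hLevel hSha

end Summit.BirchSwinnertonDyer.BirchSwinnertonDyer.Theorems.PrintCFram.EisensteinEndStateV19TwistSupply

end
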